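import Summits.FinalStateConjecture.FinalStateConjecture.Theses.StarvedNecks
import HarnessLib.Audit

/-!
# Line `bargmann-small-late-exterior` — crux `StarvedNecks.NecksCertify` (stmt-FinalStateConjecture-13549)

Skeleton (crux-plan, round 1) for the idea card
`Cruxes/NecksCertify/Ideas/bargmann-small-late-exterior.md` (triage `TRIAGE-r1-1.md`: pass, with
sharpenings (1)–(5) answered below).  Crux (FIXED, concluded BY NAME by `NecksCertify_of`):
every honest fixed-radius `C⁴` final-state decomposition of an admissible MGHD can be re-seamed into
a `C²` decomposition of the same exterior that is `HonestCore ∧ SEAMED` (`StarvedNecks.NecksCertify`).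

## The line in one paragraph

On the late exterior `Ω = {late} ∖ ⋃ⱼ {rⱼ < R₀}` of the certified cylinders the conversion
"outgoing ↦ incoming" (backscatter off the Kerr tails, the only way vacuum can refill a neck from
inside) is a linear operator whose norm in sup-type norms is the BARGMANN NORM
`η = ∫_{R₀}^∞ (s − R₀)·|coupling(s)| ds ≈ 2M/R₀ ≤ 1/50` (the crux's own `100·Mᵢ ≤ R₀`, clause 1 of
`HonestCore`); hence the field on `Ω` is `(1 − η)⁻¹ ×` (the FREE field driven by the two sources
that ARE small by hypothesis: the admissible datum's `o₂(r⁻¹)` far field, reached along incoming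
characteristics that never enter the strong-field era, and the traces on the certified cylinders at
late times), uniformly in time, with no energy budget, no dyadic shells and no restart.  The key
bookkeeping fact (why there is no secular factor `r − R₀`): integrating the incoming transport
equation along incoming rays and then the outgoing one back to the cylinder produces the DOUBLE
integral `∫_{R₀}^{r} dρ ∫_ρ^∞ |V| = ∫ (s − R₀)|V(s)| ds = η` (Fubini) — Bargmann's weight.

## Registered stubs (6 after the lead's reshape of 2026-08-16) and the composition

Lead's reshape (prover-line-…-13549-r-0, 2026-08-16): the two model rungs M1/M2 are registered in
CONDITIONAL form `TonelliBargmann → CharacteristicCalculus → …`, and the two new rungs R1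
`stub_tonelliBargmann` (measure theory of the Bargmann weight: integrability, the Tonelli double
integral, tails) and R2 `stub_characteristicCalculus` (the d'Alembert transport identities and data
facts for `C²` fields, globally on `ℝ²`) carry all the calculus, so that four workers can run at once and
M1/M2 reduce to inequality bookkeeping.  `NecksCertify_of` takes the six stubs by name.

* `stub_bargmannSupContraction` (M1, size M, model rung, provable now): the 1+1 sup-norm contraction
  `sup_Ω |ψ| ≤ (1 − η)⁻¹ sup_Ω |χ|` for `ψ_tt − ψ_rr + V(t,r)ψ = 0` on `Ω = {t ≥ T, r ≥ R₀}`,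
  `|V| ≤ ν(r)`, `∫ (s − R₀)ν ≤ η < 1`, `χ` the free solution with the same slab Cauchy data and the
  same cylinder trace, `ψ` a priori bounded (the card's `TailBornContraction`, C⁰ form; triage: needs
  `0 ≤ R₀`, stated).
* `stub_noParkingDecay` (M2, size M, model rung, provable now): under the same hypotheses, if the
  free field `χ → 0` in the late retarded region `{t − r ≥ u₀ → ∞}` then so do `ψ` and the first
  derivatives of `ψ − χ` (rate-free "no parking": the time-localised version the card asks for; the
  outgoing derivative loses nothing at the cylinder because `ψ − χ = 0` there forces
  `(∂ₜ − ∂ᵣ)(ψ − χ) = −(∂ₜ + ∂ᵣ)(ψ − χ)` on it).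
* `stub_lateExteriorNoParking` (N1, size XL, HARDEST, load-bearing): the transfer to the Einstein
  equations — M1 → M2 → for every admissible datum, MGHD and honest `C⁴` decomposition
  (`HonestCore ∧ HonestFar`, verbatim the crux's antecedents) a `NeckAtlas`: re-gauged hole charts on
  the late tubes, equal to the input hole chart inside `R₁ + 1`, equal to the flat chart outside
  continuous sublinear tubes `ρ' ≥ ρ + 1` (ONE ATLAS), smooth open embeddings into the charted region,
  `C²`-certified out to growing sublinear radii `Rg` that swallow the `ρ'`-tubes with margin 3,
  `C⁰`-honest (threshold `1/(10‖Λᵢ‖²)`) with future-directed hole time-lines there.  This is the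
  exterior characteristic stability theorem on `{rᵢ ≥ R₀}` with certified timelike inner cylinders
  (triage (3): cone-flux norms on the CK/KN Bianchi pairs commuted with `Ωᵢ, ∂ₜ`; whole late exterior
  at once; sources = datum + ALL cylinders, triage (1); high `(ℓ, ωM)` sector closed inside by
  `V_RW ≥ 0`/eikonal, triage (2); source (a) is the WEIGHTED `o₂` datum, never the unweighted flat
  certificate, triage (4)).  USES `H = (100·Mᵢ ≤ R₀)` of `HonestCore` as `η ≤ 1/50`.
* `stub_seamSurgery` (N2, size L): for every such datum/decomposition, `NeckAtlas ⇒ ∃ d₂ R R₀'` with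
  `O = exteriorOf d₂.charted ∧ HonestCore d₂ R₀' ∧ Seamed d₂ R R₀'` — packaging the atlas into a
  `FinalStateDecomposition … 2` (clock offsets, folded far leaves, shrunk flat domain, `τ₀` late) and
  the causal bookkeeping (anchoring, closures, exterior region unchanged) from the input's
  `HonestCore ∧ HonestFar`.  INHERITS the crux's paper-level `refuted-misstated` clause S12
  (coordinate-disjoint certified tubes ⇒ pairwise non-parallel boosts; rattack EVIDENCE.md §3–4,
  equal-velocity "parabolic" recessions) exactly as the crux does; under the planner's repair C′
  (distinct asymptotic 3-velocities added to `Hc`) the same stub with the extra conjunct in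
  `HonestCore` is the intended statement — no Lean `¬` exists (negatives index: 0), so no stub is an
  instance of a landed Negative lemma.

`NecksCertify_of : M1 → M2 → N1 → N2 → StarvedNecks.NecksCertify` is PROVED below (pure logic:
`N2 (N1 M1 M2)` instance-wise; the crux's let-bound `Hc/Hf/Sm` and this file's `HonestCore/HonestFar/
Seamed` are the same terms).  Disproof.lean: none on file for this crux (payload path absent,
`ledger crux ls` 2026-08-15) — nothing to honour beyond EVIDENCE.md (S12, above) and REVIEW_R2
(Schwarzschild instantiation: there `NeckAtlas` is met by `Ψ' = Ψ = id`, `ρ' = ρ + 1 ∨ R₁`,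
`Rg = 2ρ' + 8`).

Namespace `…Cruxes.NecksCertify.BargmannSmallLateExterior`; stub STATEMENTS are the `def`s
`BargmannSupContraction`, `NoParkingDecay`, `LateExteriorNoParking`, `SeamSurgery`, each followed by
its REGISTERED `theorem stub_… : <same text> := by sorry`; `Registered.stub_…` (abbrevs) are the
name-keyed hypotheses of `NecksCertify_of` (skeleton audit: hypotheses admissible iff registered stubs
by name).  Stub provers: import this module or copy the four bundle `def`s (`HonestCore`,
`HonestFar`, `Seamed`, `NeckAtlas`) verbatim.
-/

noncomputable section

open scoped Manifold ContDiff Topology ENNReal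
open Filter Set MeasureTheory Topology Literature.Geometry.Lorentzian

namespace Summit.FinalStateConjecture.FinalStateConjecture.Cruxes.NecksCertify.BargmannSmallLateExterior

set_option linter.dupNamespace false

/-! ## The crux's let-bound bundles, named (verbatim copies of `StarvedNecks.NecksCertify`) -/

/-- `HonestCore` = the crux's `Hc` (verbatim): sub-extremal holes, `100·Mᵢ ≤ R₀`, orthochronous
boosts; anchoring of hole-late points below later discs of every radius `≥ R₀`; relative closedness
of late tube portions; future-oriented flat chart. -/
def HonestCore (𝓢 : Spacetime.{0} 4) (O : Set 𝓢.carrier) (k : ℕ) (d : FinalStateDecomposition 𝓢 O k)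
    (R₀ : ℝ) : Prop :=
  let B := d.background; let t := fun i ↦ (B i).time; let r := fun i ↦ (B i).radius; let Ψ := d.chart;
  (∀ i, Kerr.IsSubextremal (d.mass i) (d.spin i) ∧ 100 * d.mass i ≤ R₀ ∧ 0 < ((d.motion i).1 : E4 ≃L[ℝ] E4) (E4.basisVector 0) 0) ∧
    (∀ i (ϱ τ₂ : ℝ), R₀ ≤ ϱ → d.τ₀ < τ₂ → Ψ i '' {x | d.τ₀ < t i x.1 ∧ t i x.1 < τ₂ ∧ r i x.1 < ϱ} ⊆ 𝓢.metric.causalPast 𝓢.timeOrientation (Ψ i '' (B i).truncTimeSlab ϱ τ₂)) ∧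
    (∀ i (τ' : ℝ) (ϱ : ℝ → ℝ), Continuous ϱ → d.τ₀ < τ' → let A := Ψ i '' {x | τ' ≤ t i x.1 ∧ r i x.1 ≤ ϱ (t i x.1)}; closure A ∩ O ⊆ A) ∧
    (∀ y : d.flatDomain, d.τ₀ < y.1 0 → 𝓢.timeOrientation.IsFutureDirected (mfderiv 𝓘(ℝ, E4) (𝓡 4) d.flatChart y (E4.basisVector 0)))

/-- `HonestFar` = the crux's `Hf` (verbatim): flat-late points below later flat slabs; closures of far
flat slabs are flat points; eventually each hole chart is `C⁰`-honest (`1/(10‖Λᵢ‖²)`) on its own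
Voronoi cell beyond `R₀` — no hidden strong field (triage: Hf(3) is load-bearing for every line). -/
def HonestFar (𝓢 : Spacetime.{0} 4) (O : Set 𝓢.carrier) (k : ℕ) (d : FinalStateDecomposition 𝓢 O k)
    (R₀ : ℝ) : Prop :=
  let B := d.background; let t := fun i ↦ (B i).time; let r := fun i ↦ (B i).radius; let Φ := d.flatChart;
  (∀ τ₂ : ℝ, d.τ₀ < τ₂ → Φ '' {y | d.τ₀ < y.1 0 ∧ y.1 0 < τ₂} ⊆ 𝓢.metric.causalPast 𝓢.timeOrientation (Φ '' (Minkowski.backgroundOn d.flatDomain).timeSlab τ₂)) ∧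
    (∀ τ' : ℝ, d.τ₀ < τ' → closure (Φ '' {y | τ' ≤ y.1 0 ∧ ∀ i, d.excision i (y.1 0) + 1 ≤ r i y.1}) ⊆ Φ '' {y | τ' ≤ y.1 0}) ∧
    (∀ i, ∃ T : ℝ, supCkENorm (Subtype.val '' {x : (B i).domain | T ≤ t i x.1 ∧ R₀ ≤ r i x.1 ∧ ∀ j, j ≠ i → r i x.1 ≤ r j x.1}) 0 (𝓢.deviationExtend (B i) (d.chart i)) ≤ ENNReal.ofReal (1 / (10 * ‖(((d.motion i).1 : E4 ≃L[ℝ] E4) : E4 →L[ℝ] E4)‖ ^ 2)))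

/-- `Seamed` = the crux's `Sm` (verbatim, 12 clauses S1–S12): radii/tube profiles; `C²` certification
out to `Rᵢ(τ)`; flat `C⁰` threshold `1/10`; hole `C⁰` threshold `1/(10‖Λᵢ‖²)` and future-directed hole
time-lines on certified tubes; ONE ATLAS; flat-late domain = tube complement; margins 2; clock lag;
far hole leaves in the radiation zone; closures; certified tubes of different holes coordinate-disjoint
(S12 — the clause rattack's EVIDENCE.md shows unsatisfiable for equal-velocity holes; repair C′ pending
at route level). -/
def Seamed (𝓢 : Spacetime.{0} 4) (O : Set 𝓢.carrier) (d : FinalStateDecomposition 𝓢 O 2)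
    (R : Fin d.N → ℝ → ℝ) (R₀ : ℝ) : Prop :=
  let B := d.background; let t := fun i ↦ (B i).time; let r := fun i ↦ (B i).radius; let Λ := fun i ↦ ((d.motion i).1 : E4 ≃L[ℝ] E4); let Φ := d.flatChart; let Ψ := d.chart; let ρ := d.excision;
  (∀ i, Monotone (R i) ∧ Continuous (R i) ∧ ∀ s, R₀ + 4 ≤ R i s ∧ R₀ ≤ ρ i s) ∧
    (∀ i, Tendsto (fun τ ↦ 𝓢.truncDeviationCk (B i) (Ψ i) 2 (R i τ) τ) atTop (𝓝 0)) ∧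
    supCkENorm (Subtype.val '' {y : d.flatDomain | d.τ₀ ≤ y.1 0}) 0 (𝓢.deviationExtend (Minkowski.backgroundOn d.flatDomain) Φ) ≤ 10⁻¹ ∧
    (∀ i, supCkENorm (Subtype.val '' {x : (B i).domain | (d.τ₀ ≤ t i x.1 ∨ d.τ₀ ≤ x.1 0) ∧ R₀ ≤ r i x.1 ∧ r i x.1 ≤ R i (t i x.1)}) 0 (𝓢.deviationExtend (B i) (Ψ i)) ≤ ENNReal.ofReal (1 / (10 * ‖(Λ i : E4 →L[ℝ] E4)‖ ^ 2))) ∧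
    (∀ i (x : (B i).domain), (d.τ₀ ≤ t i x.1 ∨ d.τ₀ ≤ x.1 0) → R₀ ≤ r i x.1 → r i x.1 ≤ R i (t i x.1) → 𝓢.timeOrientation.IsFutureDirected (mfderiv 𝓘(ℝ, E4) (𝓡 4) (Ψ i) x ((Λ i) (E4.basisVector 0)))) ∧
    (∀ i (y : E4) (hy : y ∈ (B i).domain), d.τ₀ ≤ y 0 → (∀ j, ρ j (y 0) < r j y) → r i y ≤ R i (t i y) + 1 → ∃ hy' : y ∈ d.flatDomain, Ψ i ⟨y, hy⟩ = Φ ⟨y, hy'⟩) ∧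
    (∀ y : d.flatDomain, d.τ₀ ≤ y.1 0 → ∀ j, ρ j (y.1 0) < r j y.1) ∧
    (∀ j (y : E4), d.τ₀ ≤ y 0 → r j y ≤ ρ j (y 0) → r j y + 2 ≤ R j (t j y)) ∧
    (∀ j (y : E4), d.τ₀ ≤ t j y → r j y ≤ R j (t j y) + 2 → t j y ≤ y 0) ∧
    (∀ j, Ψ j '' {x | d.τ₀ < t j x.1 ∧ R j (t j x.1) + 1 < r j x.1} ⊆ d.radiationZone) ∧
    (∀ τ' : ℝ, d.τ₀ < τ' → closure (Φ '' {y | τ' ≤ y.1 0}) ⊆ Φ '' {y | τ' ≤ y.1 0} ∪ ⋃ j, Ψ j '' {x | τ' ≤ x.1 0 ∧ r j x.1 = ρ j (x.1 0)}) ∧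
    (∀ j j' (y : E4), j ≠ j' → (d.τ₀ ≤ y 0 ∨ d.τ₀ ≤ t j y) → r j y ≤ R j (t j y) + 1 → R j' (t j' y) + 1 < r j' y)

/-! ## Model rungs (1+1 characteristic calculus; the lever in checkable form)

Conventions (as in `Theorems/PhotonSphereChannelsExteriorEnergy.lean`): `ψ : ℝ → ℝ → ℝ` curried,
`ψ t r`, jointly `C²` as `ContDiff ℝ 2 (Function.uncurry ψ)`; `∂ₜ²ψ = iteratedDeriv 2 (fun s ↦ ψ s r) t`,
`∂ᵣ²ψ = iteratedDeriv 2 (ψ t) r`.  Region `Ω = {T ≤ t} × {R₀ ≤ r}` (late exterior of the cylinder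
`r = R₀`); incoming characteristics `t + r = const` leave `Ω` backwards only through the slab `t = T`,
outgoing ones `t − r = const` through the cylinder or the slab.  `χ` is the FREE field with the same
Cauchy data on the slab and the same Dirichlet trace on the cylinder, so `ψ − χ` has zero data and
`(∂ₜ − ∂ᵣ)(∂ₜ + ∂ᵣ)(ψ − χ) = −Vψ`. -/

/-- **R1 — Tonelli for the Bargmann weight** (lead's reshape 2026-08-16; pure measure theory, no PDE).
For `ν ≥ 0` continuous on `[R₀, ∞)` with `(s − R₀)ν(s)` integrable on `(R₀, ∞)`: `ν` is integrable on
`(R₀, ∞)`; the tail integrals `I_L(ρ) = ∫_{ρ+L}^∞ ν` (`L ≥ 0`) are nonnegative and antitone in `ρ ≥ R₀`;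
the DOUBLE integral is Bargmann's weight, `∫_{R₀}^{r} I_L(ρ) dρ ≤ ∫_{R₀+L}^∞ (s − R₀) ν(s) ds`
(Tonelli: `= ∫_{s > R₀+L} (min(s − L, r) − R₀)⁺ ν(s) ds`); and both tails `∫_a^∞ ν`,
`∫_a^∞ (s − R₀)ν` tend to `0` as `a → ∞`.  This is the bookkeeping fact of the line ("no secular
factor `r − R₀`") isolated from the calculus.  Size S–M. -/
def TonelliBargmann : Prop :=
  ∀ (R₀ : ℝ) (ν : ℝ → ℝ), ContinuousOn ν (Set.Ici R₀) → (∀ s, R₀ ≤ s → 0 ≤ ν s) →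
    IntegrableOn (fun s ↦ (s - R₀) * ν s) (Set.Ioi R₀) →
    IntegrableOn ν (Set.Ioi R₀) ∧
    (∀ L ρ, 0 ≤ L → R₀ ≤ ρ → 0 ≤ ∫ s in Set.Ioi (ρ + L), ν s) ∧
    (∀ L, 0 ≤ L → AntitoneOn (fun ρ ↦ ∫ s in Set.Ioi (ρ + L), ν s) (Set.Ici R₀)) ∧
    (∀ L r, 0 ≤ L → R₀ ≤ r →
      ∫ ρ in R₀..r, (∫ s in Set.Ioi (ρ + L), ν s) ≤ ∫ s in Set.Ioi (R₀ + L), (s - R₀) * ν s) ∧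
    Tendsto (fun a ↦ ∫ s in Set.Ioi a, ν s) atTop (𝓝 0) ∧
    Tendsto (fun a ↦ ∫ s in Set.Ioi a, (s - R₀) * ν s) atTop (𝓝 0)

/-- Registered stub R1 (statement = `TonelliBargmann`, verbatim). -/
theorem stub_tonelliBargmann :
  ∀ (R₀ : ℝ) (ν : ℝ → ℝ), ContinuousOn ν (Set.Ici R₀) → (∀ s, R₀ ≤ s → 0 ≤ ν s) →
    IntegrableOn (fun s ↦ (s - R₀) * ν s) (Set.Ioi R₀) →
    IntegrableOn ν (Set.Ioi R₀) ∧
    (∀ L ρ, 0 ≤ L → R₀ ≤ ρ → 0 ≤ ∫ s in Set.Ioi (ρ + L), ν s) ∧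
    (∀ L, 0 ≤ L → AntitoneOn (fun ρ ↦ ∫ s in Set.Ioi (ρ + L), ν s) (Set.Ici R₀)) ∧
    (∀ L r, 0 ≤ L → R₀ ≤ r →
      ∫ ρ in R₀..r, (∫ s in Set.Ioi (ρ + L), ν s) ≤ ∫ s in Set.Ioi (R₀ + L), (s - R₀) * ν s) ∧
    Tendsto (fun a ↦ ∫ s in Set.Ioi a, ν s) atTop (𝓝 0) ∧
    Tendsto (fun a ↦ ∫ s in Set.Ioi a, (s - R₀) * ν s) atTop (𝓝 0) := by
  sorry

/-- **R2 — characteristic calculus of `C²` fields** (lead's reshape 2026-08-16; pure calculus, no PDE,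
no region).  For `ψ, χ ∈ C²(ℝ²)` (curried) with matching slab data at `t = T` on `r ≥ R₀` and matching
trace on the cylinder `r = R₀` for `t ≥ T`, and `φ = ψ − χ`, `w = φ_t + φ_r`, `z = φ_t − φ_r`,
`D = φ_tt − φ_rr` (written out in the route statements' `deriv`/`iteratedDeriv 2` slice form): all four
are continuous; the three d'Alembert TRANSPORT IDENTITIES hold globally, for every real `a`,
`w(t,r) = w(t−a, r+a) + ∫₀ᵃ D(t−s, r+s) ds` (incoming), `φ(t,r) = φ(t−a, r−a) + ∫₀ᵃ w(t−σ, r−σ) dσ` and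
`z(t,r) = z(t−a, r−a) + ∫₀ᵃ D(t−σ, r−σ) dσ` (outgoing) — FTC along the characteristics plus Schwarz
`φ_tr = φ_rt` (`Theorems/PhotonSphereChannelsBlindnessWaveCalculus`: `mixed_partials_eq`, slice
dictionary `deriv_time_eq/deriv_space_eq/iteratedDeriv_time_eq/iteratedDeriv_space_eq`); and the DATA
FACTS: `φ = w = z = 0` on the slab `{t = T, r ≥ R₀}`, `φ = 0` and `z = −w` on the cylinder `{r = R₀, t ≥ T}`
(one-sided derivatives of functions vanishing on a closed half-line vanish at the endpoint too).  Size M. -/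
def CharacteristicCalculus : Prop :=
  ∀ (T R₀ : ℝ) (ψ χ : ℝ → ℝ → ℝ),
    ContDiff ℝ 2 (Function.uncurry ψ) → ContDiff ℝ 2 (Function.uncurry χ) →
    (∀ r, R₀ ≤ r → χ T r = ψ T r ∧ deriv (fun s ↦ χ s r) T = deriv (fun s ↦ ψ s r) T) →
    (∀ t, T ≤ t → χ t R₀ = ψ t R₀) →
    let φ : ℝ → ℝ → ℝ := fun t r ↦ ψ t r - χ t r
    let w : ℝ → ℝ → ℝ := fun t r ↦
      deriv (fun s ↦ ψ s r - χ s r) t + deriv (fun s ↦ ψ t s - χ t s) r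
    let z : ℝ → ℝ → ℝ := fun t r ↦
      deriv (fun s ↦ ψ s r - χ s r) t - deriv (fun s ↦ ψ t s - χ t s) r
    let D : ℝ → ℝ → ℝ := fun t r ↦
      (iteratedDeriv 2 (fun s ↦ ψ s r) t - iteratedDeriv 2 (ψ t) r) -
        (iteratedDeriv 2 (fun s ↦ χ s r) t - iteratedDeriv 2 (χ t) r)
    Continuous (Function.uncurry φ) ∧ Continuous (Function.uncurry w) ∧
      Continuous (Function.uncurry z) ∧ Continuous (Function.uncurry D) ∧
    (∀ t r a : ℝ, w t r = w (t - a) (r + a) + ∫ s in (0 : ℝ)..a, D (t - s) (r + s)) ∧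
    (∀ t r a : ℝ, φ t r = φ (t - a) (r - a) + ∫ s in (0 : ℝ)..a, w (t - s) (r - s)) ∧
    (∀ t r a : ℝ, z t r = z (t - a) (r - a) + ∫ s in (0 : ℝ)..a, D (t - s) (r - s)) ∧
    (∀ r, R₀ ≤ r → φ T r = 0 ∧ w T r = 0 ∧ z T r = 0) ∧
    (∀ t, T ≤ t → φ t R₀ = 0 ∧ z t R₀ = -w t R₀)

/-- Registered stub R2 (statement = `CharacteristicCalculus`, verbatim). -/
theorem stub_characteristicCalculus :
  ∀ (T R₀ : ℝ) (ψ χ : ℝ → ℝ → ℝ),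
    ContDiff ℝ 2 (Function.uncurry ψ) → ContDiff ℝ 2 (Function.uncurry χ) →
    (∀ r, R₀ ≤ r → χ T r = ψ T r ∧ deriv (fun s ↦ χ s r) T = deriv (fun s ↦ ψ s r) T) →
    (∀ t, T ≤ t → χ t R₀ = ψ t R₀) →
    let φ : ℝ → ℝ → ℝ := fun t r ↦ ψ t r - χ t r
    let w : ℝ → ℝ → ℝ := fun t r ↦
      deriv (fun s ↦ ψ s r - χ s r) t + deriv (fun s ↦ ψ t s - χ t s) r
    let z : ℝ → ℝ → ℝ := fun t r ↦
      deriv (fun s ↦ ψ s r - χ s r) t - deriv (fun s ↦ ψ t s - χ t s) r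
    let D : ℝ → ℝ → ℝ := fun t r ↦
      (iteratedDeriv 2 (fun s ↦ ψ s r) t - iteratedDeriv 2 (ψ t) r) -
        (iteratedDeriv 2 (fun s ↦ χ s r) t - iteratedDeriv 2 (χ t) r)
    Continuous (Function.uncurry φ) ∧ Continuous (Function.uncurry w) ∧
      Continuous (Function.uncurry z) ∧ Continuous (Function.uncurry D) ∧
    (∀ t r a : ℝ, w t r = w (t - a) (r + a) + ∫ s in (0 : ℝ)..a, D (t - s) (r + s)) ∧
    (∀ t r a : ℝ, φ t r = φ (t - a) (r - a) + ∫ s in (0 : ℝ)..a, w (t - s) (r - s)) ∧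
    (∀ t r a : ℝ, z t r = z (t - a) (r - a) + ∫ s in (0 : ℝ)..a, D (t - s) (r - s)) ∧
    (∀ r, R₀ ≤ r → φ T r = 0 ∧ w T r = 0 ∧ z T r = 0) ∧
    (∀ t, T ≤ t → φ t R₀ = 0 ∧ z t R₀ = -w t R₀) := by
  sorry

/-- **M1 — Bargmann sup-norm contraction** (the card's `TailBornContraction`, `C⁰` form; triage:
TRUE for `R₀ ≥ 0`).  REGISTERED (lead's reshape 2026-08-16) in the CONDITIONAL form
`TonelliBargmann → CharacteristicCalculus → BargmannSupContraction`: all calculus and measure theory is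
in R1/R2, what remains is the contraction algebra below.  If `|V(t,r)| ≤ ν(r)` with BARGMANN NORM `∫_{R₀}^∞ (s − R₀) ν(s) ds ≤ η < 1`, `ψ`
solves `ψ_tt − ψ_rr + Vψ = 0` on `Ω`, `χ` solves the free equation on `Ω` with the same slab Cauchy
data and cylinder trace, `ψ` is a priori bounded on `Ω` and `|χ| ≤ C` on `Ω`, then
`|ψ| ≤ C/(1 − η)` on `Ω`.  Proof sketch (checked line by line in TRIAGE-r1-1 §C and the line card):
`w := (∂ₜ + ∂ᵣ)(ψ − χ)` vanishes on the slab and `w(t,r) = −∫₀^{t−T} (Vψ)(t − s, r + s) ds`;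
`(ψ − χ)(t,r) = ∫₀^{σ*} w(t − σ, r − σ) dσ` (foot on cylinder or slab, where `ψ − χ = 0`); hence
`|ψ − χ| ≤ sup|ψ| · ∫_{R₀}^{r} dρ ∫_ρ^∞ ν = sup|ψ| · ∫ (s − R₀)ν ≤ η sup|ψ|` (Tonelli; `ρ ≥ R₀ ≥ 0`),
and `sup|ψ| ≤ C + η sup|ψ|`.  Size M. -/
def BargmannSupContraction : Prop :=
  ∀ (T R₀ η C : ℝ) (ν : ℝ → ℝ) (V ψ χ : ℝ → ℝ → ℝ),
    0 ≤ R₀ → η < 1 →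
    ContinuousOn ν (Set.Ici R₀) →
    IntegrableOn (fun s ↦ (s - R₀) * ν s) (Set.Ioi R₀) →
    (∫ s in Set.Ioi R₀, (s - R₀) * ν s) ≤ η →
    (∀ t r, T ≤ t → R₀ ≤ r → |V t r| ≤ ν r) →
    ContDiff ℝ 2 (Function.uncurry ψ) → ContDiff ℝ 2 (Function.uncurry χ) →
    (∀ t r, T ≤ t → R₀ ≤ r →
      iteratedDeriv 2 (fun s ↦ ψ s r) t - iteratedDeriv 2 (ψ t) r + V t r * ψ t r = 0) →
    (∀ t r, T ≤ t → R₀ ≤ r → iteratedDeriv 2 (fun s ↦ χ s r) t - iteratedDeriv 2 (χ t) r = 0) →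
    (∀ r, R₀ ≤ r → χ T r = ψ T r ∧ deriv (fun s ↦ χ s r) T = deriv (fun s ↦ ψ s r) T) →
    (∀ t, T ≤ t → χ t R₀ = ψ t R₀) →
    (∃ P : ℝ, ∀ t r, T ≤ t → R₀ ≤ r → |ψ t r| ≤ P) →
    (∀ t r, T ≤ t → R₀ ≤ r → |χ t r| ≤ C) →
    ∀ t r, T ≤ t → R₀ ≤ r → |ψ t r| ≤ C / (1 - η)

/-- Registered stub M1 (statement = `TonelliBargmann → CharacteristicCalculus → BargmannSupContraction`,
all three unfolded verbatim so that the stub file needs no `def`).  Proof route: `φ := ψ − χ`; R2's `D = −Vψ` on `Ω` (the two equations);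
incoming identity with `a := t − T` (foot on the slab, `w = 0` there) gives
`|w(t,r)| ≤ S·∫_{r}^{∞} ν` with `S` any bound of `|ψ|` on `Ω`; outgoing identity with
`a := min (t − T) (r − R₀)` (foot on slab or cylinder, `φ = 0` there) and R1's double-integral bound
(`L := 0`) give `|φ| ≤ S·η`; hence `|ψ| ≤ C + η·S` on `Ω`; iterate `S ↦ C + ηS` from the a-priori
bound `P` (or take `S := sup`) to reach `C/(1 − η)` (`0 ≤ η` from `ν ≥ |V| ≥ 0`). -/
theorem stub_bargmannSupContraction :
  (∀ (R₀ : ℝ) (ν : ℝ → ℝ), ContinuousOn ν (Set.Ici R₀) → (∀ s, R₀ ≤ s → 0 ≤ ν s) →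
      IntegrableOn (fun s ↦ (s - R₀) * ν s) (Set.Ioi R₀) →
      IntegrableOn ν (Set.Ioi R₀) ∧
      (∀ L ρ, 0 ≤ L → R₀ ≤ ρ → 0 ≤ ∫ s in Set.Ioi (ρ + L), ν s) ∧
      (∀ L, 0 ≤ L → AntitoneOn (fun ρ ↦ ∫ s in Set.Ioi (ρ + L), ν s) (Set.Ici R₀)) ∧
      (∀ L r, 0 ≤ L → R₀ ≤ r →
        ∫ ρ in R₀..r, (∫ s in Set.Ioi (ρ + L), ν s) ≤ ∫ s in Set.Ioi (R₀ + L), (s - R₀) * ν s) ∧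
      Tendsto (fun a ↦ ∫ s in Set.Ioi a, ν s) atTop (𝓝 0) ∧
      Tendsto (fun a ↦ ∫ s in Set.Ioi a, (s - R₀) * ν s) atTop (𝓝 0)) →
  (∀ (T R₀ : ℝ) (ψ χ : ℝ → ℝ → ℝ),
      ContDiff ℝ 2 (Function.uncurry ψ) → ContDiff ℝ 2 (Function.uncurry χ) →
      (∀ r, R₀ ≤ r → χ T r = ψ T r ∧ deriv (fun s ↦ χ s r) T = deriv (fun s ↦ ψ s r) T) →
      (∀ t, T ≤ t → χ t R₀ = ψ t R₀) →
      let φ : ℝ → ℝ → ℝ := fun t r ↦ ψ t r - χ t r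
      let w : ℝ → ℝ → ℝ := fun t r ↦
        deriv (fun s ↦ ψ s r - χ s r) t + deriv (fun s ↦ ψ t s - χ t s) r
      let z : ℝ → ℝ → ℝ := fun t r ↦
        deriv (fun s ↦ ψ s r - χ s r) t - deriv (fun s ↦ ψ t s - χ t s) r
      let D : ℝ → ℝ → ℝ := fun t r ↦
        (iteratedDeriv 2 (fun s ↦ ψ s r) t - iteratedDeriv 2 (ψ t) r) -
          (iteratedDeriv 2 (fun s ↦ χ s r) t - iteratedDeriv 2 (χ t) r)
      Continuous (Function.uncurry φ) ∧ Continuous (Function.uncurry w) ∧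
        Continuous (Function.uncurry z) ∧ Continuous (Function.uncurry D) ∧
      (∀ t r a : ℝ, w t r = w (t - a) (r + a) + ∫ s in (0 : ℝ)..a, D (t - s) (r + s)) ∧
      (∀ t r a : ℝ, φ t r = φ (t - a) (r - a) + ∫ s in (0 : ℝ)..a, w (t - s) (r - s)) ∧
      (∀ t r a : ℝ, z t r = z (t - a) (r - a) + ∫ s in (0 : ℝ)..a, D (t - s) (r - s)) ∧
      (∀ r, R₀ ≤ r → φ T r = 0 ∧ w T r = 0 ∧ z T r = 0) ∧
      (∀ t, T ≤ t → φ t R₀ = 0 ∧ z t R₀ = -w t R₀)) →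
  ∀ (T R₀ η C : ℝ) (ν : ℝ → ℝ) (V ψ χ : ℝ → ℝ → ℝ),
    0 ≤ R₀ → η < 1 →
    ContinuousOn ν (Set.Ici R₀) →
    IntegrableOn (fun s ↦ (s - R₀) * ν s) (Set.Ioi R₀) →
    (∫ s in Set.Ioi R₀, (s - R₀) * ν s) ≤ η →
    (∀ t r, T ≤ t → R₀ ≤ r → |V t r| ≤ ν r) →
    ContDiff ℝ 2 (Function.uncurry ψ) → ContDiff ℝ 2 (Function.uncurry χ) →
    (∀ t r, T ≤ t → R₀ ≤ r →
      iteratedDeriv 2 (fun s ↦ ψ s r) t - iteratedDeriv 2 (ψ t) r + V t r * ψ t r = 0) →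
    (∀ t r, T ≤ t → R₀ ≤ r → iteratedDeriv 2 (fun s ↦ χ s r) t - iteratedDeriv 2 (χ t) r = 0) →
    (∀ r, R₀ ≤ r → χ T r = ψ T r ∧ deriv (fun s ↦ χ s r) T = deriv (fun s ↦ ψ s r) T) →
    (∀ t, T ≤ t → χ t R₀ = ψ t R₀) →
    (∃ P : ℝ, ∀ t r, T ≤ t → R₀ ≤ r → |ψ t r| ≤ P) →
    (∀ t r, T ≤ t → R₀ ≤ r → |χ t r| ≤ C) →
    ∀ t r, T ≤ t → R₀ ≤ r → |ψ t r| ≤ C / (1 - η) := by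
  sorry

/-- **M2 — rate-free no-parking in the late retarded region** (the card's time-localised rung).
Same setting as M1, `|ψ| ≤ P` on `Ω`.  If the free field is eventually small beyond every retarded
time, `∀ ε > 0 ∃ u₀, |χ| ≤ ε on Ω ∩ {t − r ≥ u₀}`, then so is `ψ`, and so are BOTH first derivatives
of `ψ − χ`.  Proof sketch: with `N(u₀) := sup {|ψ(t,r)| : t − r ≥ u₀}` (non-increasing, `≤ P`), the
source points feeding `(ψ − χ)(t,r)` through the double integral have retarded time `t − r − 2(s − ρ)`,
so splitting `s − ρ ≤ L` / `> L` gives `N(u₀) ≤ N_χ(u₀) + η·N(u₀ − 2L) + P·∫_{R₀+L}^∞ (s − R₀)ν`; letting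
`u₀ → ∞` then `L → ∞`: `lim N ≤ η·lim N`, i.e. `lim N = 0`.  Derivatives: `w = (∂ₜ + ∂ᵣ)(ψ − χ)` is an
incoming-ray integral of `Vψ` (same splitting, `∫ν < ∞` by continuity of `ν` on `[R₀, R₀+1]`), and
`z = (∂ₜ − ∂ᵣ)(ψ − χ)` is transported along outgoing rays from the cylinder where `z = −w`
(`ψ − χ ≡ 0` there kills `∂ₜ`), plus `∫ ν|ψ|` over points of the same retarded time.  Size M. -/
def NoParkingDecay : Prop :=
  ∀ (T R₀ η P : ℝ) (ν : ℝ → ℝ) (V ψ χ : ℝ → ℝ → ℝ),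
    0 ≤ R₀ → η < 1 →
    ContinuousOn ν (Set.Ici R₀) →
    IntegrableOn (fun s ↦ (s - R₀) * ν s) (Set.Ioi R₀) →
    (∫ s in Set.Ioi R₀, (s - R₀) * ν s) ≤ η →
    (∀ t r, T ≤ t → R₀ ≤ r → |V t r| ≤ ν r) →
    ContDiff ℝ 2 (Function.uncurry ψ) → ContDiff ℝ 2 (Function.uncurry χ) →
    (∀ t r, T ≤ t → R₀ ≤ r →
      iteratedDeriv 2 (fun s ↦ ψ s r) t - iteratedDeriv 2 (ψ t) r + V t r * ψ t r = 0) →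
    (∀ t r, T ≤ t → R₀ ≤ r → iteratedDeriv 2 (fun s ↦ χ s r) t - iteratedDeriv 2 (χ t) r = 0) →
    (∀ r, R₀ ≤ r → χ T r = ψ T r ∧ deriv (fun s ↦ χ s r) T = deriv (fun s ↦ ψ s r) T) →
    (∀ t, T ≤ t → χ t R₀ = ψ t R₀) →
    (∀ t r, T ≤ t → R₀ ≤ r → |ψ t r| ≤ P) →
    (∀ ε > 0, ∃ u₀ : ℝ, ∀ t r, T ≤ t → R₀ ≤ r → u₀ ≤ t - r → |χ t r| ≤ ε) →
    ∀ ε > 0, ∃ u₀ : ℝ, ∀ t r, T ≤ t → R₀ ≤ r → u₀ ≤ t - r →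
      |ψ t r| ≤ ε ∧ |deriv (fun s ↦ ψ s r - χ s r) t| ≤ ε ∧ |deriv (fun s ↦ ψ t s - χ t s) r| ≤ ε

/-- Registered stub M2 (statement = `TonelliBargmann → CharacteristicCalculus → NoParkingDecay`, all three
unfolded verbatim so that the stub file needs no `def`).  Proof route: with `N(u) := sup {|ψ(t,r)| : (t,r) ∈ Ω, u ≤ t − r}`
(antitone, `0 ≤ N ≤ P`, limit `ℓ`): the source points of the double integral feeding `φ(t,r)` have
retarded time `t − r − 2s`; split `s ≤ L` / `s > L` (R1 with `L`, and its two tails):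
`N(u₀) ≤ N_χ(u₀) + η·N(u₀ − 2L) + P·∫_{R₀+L}^∞ (s − R₀)ν`, so `ℓ ≤ ηℓ`, `ℓ = 0`; then
`|w(t,r)| ≤ N(u₀ − 2L)·∫_{R₀}^∞ ν + P·∫_{R₀+L}^∞ ν` (incoming identity) and
`|z(t,r)| ≤ |w(foot)| + N(u₀)·∫_{R₀}^∞ ν` (outgoing identity for `z`, `z = −w` on the cylinder, `z = 0`
on the slab; the source points have the SAME retarded time), and `φ_t = (w + z)/2`, `φ_r = (w − z)/2`. -/
theorem stub_noParkingDecay :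
  (∀ (R₀ : ℝ) (ν : ℝ → ℝ), ContinuousOn ν (Set.Ici R₀) → (∀ s, R₀ ≤ s → 0 ≤ ν s) →
      IntegrableOn (fun s ↦ (s - R₀) * ν s) (Set.Ioi R₀) →
      IntegrableOn ν (Set.Ioi R₀) ∧
      (∀ L ρ, 0 ≤ L → R₀ ≤ ρ → 0 ≤ ∫ s in Set.Ioi (ρ + L), ν s) ∧
      (∀ L, 0 ≤ L → AntitoneOn (fun ρ ↦ ∫ s in Set.Ioi (ρ + L), ν s) (Set.Ici R₀)) ∧
      (∀ L r, 0 ≤ L → R₀ ≤ r →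
        ∫ ρ in R₀..r, (∫ s in Set.Ioi (ρ + L), ν s) ≤ ∫ s in Set.Ioi (R₀ + L), (s - R₀) * ν s) ∧
      Tendsto (fun a ↦ ∫ s in Set.Ioi a, ν s) atTop (𝓝 0) ∧
      Tendsto (fun a ↦ ∫ s in Set.Ioi a, (s - R₀) * ν s) atTop (𝓝 0)) →
  (∀ (T R₀ : ℝ) (ψ χ : ℝ → ℝ → ℝ),
      ContDiff ℝ 2 (Function.uncurry ψ) → ContDiff ℝ 2 (Function.uncurry χ) →
      (∀ r, R₀ ≤ r → χ T r = ψ T r ∧ deriv (fun s ↦ χ s r) T = deriv (fun s ↦ ψ s r) T) →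
      (∀ t, T ≤ t → χ t R₀ = ψ t R₀) →
      let φ : ℝ → ℝ → ℝ := fun t r ↦ ψ t r - χ t r
      let w : ℝ → ℝ → ℝ := fun t r ↦
        deriv (fun s ↦ ψ s r - χ s r) t + deriv (fun s ↦ ψ t s - χ t s) r
      let z : ℝ → ℝ → ℝ := fun t r ↦
        deriv (fun s ↦ ψ s r - χ s r) t - deriv (fun s ↦ ψ t s - χ t s) r
      let D : ℝ → ℝ → ℝ := fun t r ↦
        (iteratedDeriv 2 (fun s ↦ ψ s r) t - iteratedDeriv 2 (ψ t) r) -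
          (iteratedDeriv 2 (fun s ↦ χ s r) t - iteratedDeriv 2 (χ t) r)
      Continuous (Function.uncurry φ) ∧ Continuous (Function.uncurry w) ∧
        Continuous (Function.uncurry z) ∧ Continuous (Function.uncurry D) ∧
      (∀ t r a : ℝ, w t r = w (t - a) (r + a) + ∫ s in (0 : ℝ)..a, D (t - s) (r + s)) ∧
      (∀ t r a : ℝ, φ t r = φ (t - a) (r - a) + ∫ s in (0 : ℝ)..a, w (t - s) (r - s)) ∧
      (∀ t r a : ℝ, z t r = z (t - a) (r - a) + ∫ s in (0 : ℝ)..a, D (t - s) (r - s)) ∧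
      (∀ r, R₀ ≤ r → φ T r = 0 ∧ w T r = 0 ∧ z T r = 0) ∧
      (∀ t, T ≤ t → φ t R₀ = 0 ∧ z t R₀ = -w t R₀)) →
  ∀ (T R₀ η P : ℝ) (ν : ℝ → ℝ) (V ψ χ : ℝ → ℝ → ℝ),
    0 ≤ R₀ → η < 1 →
    ContinuousOn ν (Set.Ici R₀) →
    IntegrableOn (fun s ↦ (s - R₀) * ν s) (Set.Ioi R₀) →
    (∫ s in Set.Ioi R₀, (s - R₀) * ν s) ≤ η →
    (∀ t r, T ≤ t → R₀ ≤ r → |V t r| ≤ ν r) →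
    ContDiff ℝ 2 (Function.uncurry ψ) → ContDiff ℝ 2 (Function.uncurry χ) →
    (∀ t r, T ≤ t → R₀ ≤ r →
      iteratedDeriv 2 (fun s ↦ ψ s r) t - iteratedDeriv 2 (ψ t) r + V t r * ψ t r = 0) →
    (∀ t r, T ≤ t → R₀ ≤ r → iteratedDeriv 2 (fun s ↦ χ s r) t - iteratedDeriv 2 (χ t) r = 0) →
    (∀ r, R₀ ≤ r → χ T r = ψ T r ∧ deriv (fun s ↦ χ s r) T = deriv (fun s ↦ ψ s r) T) →
    (∀ t, T ≤ t → χ t R₀ = ψ t R₀) →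
    (∀ t r, T ≤ t → R₀ ≤ r → |ψ t r| ≤ P) →
    (∀ ε > 0, ∃ u₀ : ℝ, ∀ t r, T ≤ t → R₀ ≤ r → u₀ ≤ t - r → |χ t r| ≤ ε) →
    ∀ ε > 0, ∃ u₀ : ℝ, ∀ t r, T ≤ t → R₀ ≤ r → u₀ ≤ t - r →
      |ψ t r| ≤ ε ∧ |deriv (fun s ↦ ψ s r - χ s r) t| ≤ ε ∧ |deriv (fun s ↦ ψ t s - χ t s) r| ≤ ε := by
  sorry

/-! ## The typed interface between the analysis (N1) and the seam (N2) -/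

/-- **NeckAtlas** of an input `C⁴` decomposition `d` with honest radius `R₀`: what the late-exterior
analysis must deliver for the seam.  There are `R₁ ≥ R₀`, a late hole time `τ₁ ≥ τ₀`, continuous
SUBLINEAR flat-tube profiles `ρ'ᵢ ≥ R₁ + 1`, `ρ'ᵢ(s) ≥ ρᵢ(s) + 1` for `s ≥ τ₁` (`ρᵢ` is eventually `≤ s`,
so a continuous sublinear majorant exists from some time on), monotone continuous sublinear certified
radii `Rgᵢ ≥ R₁ + 4` and RE-GAUGED hole charts `Ψ'ᵢ` on the boosted Kerr domains such that:
(A5) the certified tubes swallow the `ρ'`-tubes with margin 3 (flat clock inside `ρ'`, hole clock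
inside `Rg`, as in SEAMED's S8); (A1) on the extended late tubes `U = {τ₁ < tᵢ, rᵢ < Rgᵢ(tᵢ) + 2}` each
`Ψ'ᵢ` is smooth and an open embedding INTO THE INPUT'S CHARTED REGION (pins the new leaves to the old
geometry; no time-shift costume); (A2) `Ψ'ᵢ = Ψᵢ` inside `R₁ + 1` (near zone untouched — anchoring and
closedness near the horizon are inherited); (A3) ONE ATLAS: at flat-late points outside all
`ρ'`-tubes and within `Rgᵢ + 2` of hole `i`, `Ψ'ᵢ = Φ`; (A6) `C²` CERTIFICATION of `Ψ'ᵢ` against boosted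
Kerr `(Mᵢ, aᵢ, Λᵢ, cᵢ)` out to `Rgᵢ(τ)` — the analytic content; (A7) `C⁰` honesty `1/(10‖Λᵢ‖²)` and
(A8) future-directed pushed hole time-lines `Λᵢe₀` on `{τ₁ ≤ tᵢ, R₁ ≤ rᵢ ≤ Rgᵢ + 1}`.  On exact
boosted Schwarzschild (REVIEW_R2) it holds with `Ψ' = Ψ`.  Clock lag (S9), far-leaf folding (S10),
closures (S11), disjointness (S12) and the packaging into a `FinalStateDecomposition … 2` are NOT
asked here — they are the seam's (N2). -/
def NeckAtlas (𝓢 : Spacetime.{0} 4) (O : Set 𝓢.carrier) (d : FinalStateDecomposition 𝓢 O 4)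
    (R₀ : ℝ) : Prop :=
  let B := d.background; let t := fun i ↦ (B i).time; let r := fun i ↦ (B i).radius
  let Λ := fun i ↦ ((d.motion i).1 : E4 ≃L[ℝ] E4); let Φ := d.flatChart; let Ψ := d.chart
  let ρ := d.excision
  ∃ (R₁ τ₁ : ℝ) (ρ' Rg : Fin d.N → ℝ → ℝ) (Ψ' : ∀ i, (B i).domain → 𝓢.carrier),
    R₀ ≤ R₁ ∧ d.τ₀ ≤ τ₁ ∧
    (∀ i, Continuous (ρ' i) ∧ Tendsto (fun s ↦ ρ' i s / s) atTop (𝓝 0) ∧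
      ∀ s, R₁ + 1 ≤ ρ' i s ∧ (τ₁ ≤ s → ρ i s + 1 ≤ ρ' i s)) ∧
    (∀ i, Monotone (Rg i) ∧ Continuous (Rg i) ∧ Tendsto (fun s ↦ Rg i s / s) atTop (𝓝 0) ∧
      ∀ s, R₁ + 4 ≤ Rg i s) ∧
    (∀ j (y : E4), τ₁ ≤ y 0 → r j y ≤ ρ' j (y 0) → r j y + 3 ≤ Rg j (t j y)) ∧
    (∀ i, let U : Set (B i).domain := {x | τ₁ < t i x.1 ∧ r i x.1 < Rg i (t i x.1) + 2}
      ContMDiffOn 𝓘(ℝ, E4) (𝓡 4) ∞ (Ψ' i) U ∧ IsOpenEmbedding (U.restrict (Ψ' i)) ∧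
        Ψ' i '' U ⊆ d.charted) ∧
    (∀ i (x : (B i).domain), r i x.1 ≤ R₁ + 1 → Ψ' i x = Ψ i x) ∧
    (∀ i (y : E4) (hy : y ∈ (B i).domain), τ₁ ≤ y 0 → (∀ j, ρ' j (y 0) < r j y) →
      r i y ≤ Rg i (t i y) + 2 → ∃ hy' : y ∈ d.flatDomain, Ψ' i ⟨y, hy⟩ = Φ ⟨y, hy'⟩) ∧
    (∀ i, Tendsto (fun τ ↦ 𝓢.truncDeviationCk (B i) (Ψ' i) 2 (Rg i τ) τ) atTop (𝓝 0)) ∧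
    (∀ i, supCkENorm (Subtype.val '' {x : (B i).domain | τ₁ ≤ t i x.1 ∧ R₁ ≤ r i x.1 ∧
        r i x.1 ≤ Rg i (t i x.1) + 1}) 0 (𝓢.deviationExtend (B i) (Ψ' i)) ≤
      ENNReal.ofReal (1 / (10 * ‖(Λ i : E4 →L[ℝ] E4)‖ ^ 2))) ∧
    (∀ i (x : (B i).domain), τ₁ ≤ t i x.1 → R₁ ≤ r i x.1 → r i x.1 ≤ Rg i (t i x.1) + 1 →
      𝓢.timeOrientation.IsFutureDirected
        (mfderiv 𝓘(ℝ, E4) (𝓡 4) (Ψ' i) x ((Λ i) (E4.basisVector 0))))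

/-! ## Nonlinear rungs -/

/-- **N1 — late-exterior no-parking (Bianchi contraction; XL, HARDEST, load-bearing).**  Granted the
two model rungs, for EVERY admissible datum `D`, MGHD `𝒟`, region `O`, `C⁴` decomposition `d` of `O`
with `O = exteriorOf 𝒟 d.charted`, `HonestCore(d, R₀)` and `HonestFar(d, R₀)` (verbatim the crux's
antecedents), a `NeckAtlas 𝒟 O d R₀` exists.  Intended proof = the card's lever run on the Einstein
equations: on `Ω = {flat-late} ∖ ⋃ⱼ{rⱼ < R₀}` (ALL cylinders excised, triage (1): other holes are late
certified sources crossed at `t* ≈ τ/(1 + vᵢⱼ) → ∞`), in a double-null gauge anchored on the certified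
spheres `{tᵢ = τ, rᵢ = R₁}`, the CK/KN Bianchi pairs split into cylinder-borne quantities transported
OUTWARD (`ρ − ρ_Kerr, σ, β̲, α̲`: small at the cylinder by fixed-radius `C⁴` convergence at late times)
and incoming quantities `(α, β)` transported INWARD from the far field, where they are small by the
admissible datum's WEIGHTED `o₂(r⁻¹)` fall-off (triage (4); the far leg of every incoming ray lies in a
Klainerman–Nicolò exterior region of the datum, bib `KlainermanNicolo2003`, then crosses the early
outgoing burst only where it is dilute, `r ≈ τ/2`); the coupling coefficients have Bargmann norm
`∫ s|·| ds ≲ M/R₀ + C·(bootstrap norm) ≤ 1/50 + …` — THIS IS WHERE `H := (100·Mᵢ ≤ R₀)` of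
`HonestCore` is used — the `1/r` outgoing field `α̲` entering only through `χ̂·α̲` in the `ρ`-equation
(Bondi mass loss, integrable: it re-normalises the charges `M_ADM ↦ Mᵢ`, it does not source `(α, β)`
with a non-integrable weight; barrier `WaveCoordinatesNullConditionFailure` evaded by the double-null
frame).  The contraction is run in cone-FLUX norms commuted with `Ωᵢⱼ, ∂ₜ` (triage (3): a sup-norm
sweep loses a derivative through `∇̸ρ, ∇̸σ, ∇̸⊗̂β`), i.e. N1 is an exterior CHARACTERISTIC STABILITY
theorem on `{rᵢ ≥ R₀}` with certified timelike inner cylinders, whole late exterior at once, sources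
= datum + cylinders, no restart (Caciotta–Nicolò doi:10.1007/s00023-010-0032-9, Shen
arXiv:2303.12758 as templates; M1/M2 enter literally for the spherical means and as the template with
the free centrifugal dynamics conjugated out — Riemann function `P_ℓ`, `|P_ℓ| ≤ 1` — for each
multipole; the high-`(ℓ, ωM)` sector is closed INSIDE this stub by `V_RW ≥ 0` (no bound states for any
`ℓ`) and WKB-small reflection off the smooth `M/r³` tail, uniformly in `(ℓ, ω)`, triage (2)).  Output
gauge: the re-gauged charts `Ψ'ᵢ` = input hole chart inside `R₁ + 1`, double-null-built Kerr–Schild-type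
coordinates on the neck, blended to `Φ` (one atlas) on the collar outside `ρ'ᵢ := ` a continuous
sublinear majorant of `ρᵢ + 1`; `C²` out (C⁴ in, two derivatives spent on the gauge).  Why it might
fail: a non-integrable coupling of `α̲` into `(α, β)` (card falsifier (ii)), or neck-born nonlinear
tails (Luk–Oh arXiv:2404.02220) not captured by a time-independent radial majorant `ν`.  KNOWN DEFECT
shared with the crux (not introduced here): for equal-velocity multi-hole inputs (rattack EVIDENCE.md
§4, "parabolic" recessions, if such MGHDs exist) `NeckAtlas` is unsatisfiable — the certified ball of
hole `i`, whose boundary sphere A3 pins to `Φ`'s coordinate sphere of radius `Rgᵢ ≫ dᵢⱼ ~ t^{2/3}`, would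
have to contain hole `j` — exactly as the crux's S8/S12 are; the route's repair C′ (pairwise distinct
asymptotic 3-velocities added to `Hc`) enters every stub of this file as an extra `HonestCore` conjunct
and makes `dᵢⱼ` linear, after which this is the intended statement. -/
def LateExteriorNoParking : Prop :=
  ∀ (X : Type) [TopologicalSpace X] [ChartedSpace E3 X] [IsManifold (𝓡 3) ∞ X] [ConnectedSpace X]
    (D : InitialDataSet (𝓡 3) X), D ∈ admissibleVacuumData X →
    ∀ 𝒟 : VacuumCauchyDevelopment D, 𝒟.IsMaximal →
    ∀ (O : Set 𝒟.carrier) (d : FinalStateDecomposition 𝒟.toSpacetime O 4) (R₀ : ℝ),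
      O = exteriorOf 𝒟.toCauchyDevelopment d.charted →
      HonestCore 𝒟.toSpacetime O 4 d R₀ → HonestFar 𝒟.toSpacetime O 4 d R₀ →
      NeckAtlas 𝒟.toSpacetime O d R₀

/-- Registered stub N1 (statement = `BargmannSupContraction → NoParkingDecay → LateExteriorNoParking`,
the last unfolded verbatim).  HARDEST stub of the line. -/
theorem stub_lateExteriorNoParking : BargmannSupContraction → NoParkingDecay →
  ∀ (X : Type) [TopologicalSpace X] [ChartedSpace E3 X] [IsManifold (𝓡 3) ∞ X] [ConnectedSpace X]
    (D : InitialDataSet (𝓡 3) X), D ∈ admissibleVacuumData X →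
    ∀ 𝒟 : VacuumCauchyDevelopment D, 𝒟.IsMaximal →
    ∀ (O : Set 𝒟.carrier) (d : FinalStateDecomposition 𝒟.toSpacetime O 4) (R₀ : ℝ),
      O = exteriorOf 𝒟.toCauchyDevelopment d.charted →
      HonestCore 𝒟.toSpacetime O 4 d R₀ → HonestFar 𝒟.toSpacetime O 4 d R₀ →
      NeckAtlas 𝒟.toSpacetime O d R₀ := by
  sorry

/-- **N2 — seam surgery (L).**  For every admissible datum, MGHD, `O`, honest `C⁴` decomposition `d`
(`O = exteriorOf 𝒟 d.charted`, `HonestCore`, `HonestFar`) carrying a `NeckAtlas`, there is a `C²`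
decomposition `d₂` of the SAME `O` with `O = exteriorOf 𝒟 d₂.charted`, `HonestCore(d₂, R₀')` and
`Seamed(d₂, R, R₀')`.  Construction: `d₂` keeps `N, Mᵢ, aᵢ, Λᵢ`; shifts the clock offsets `cᵢ⁰`
(REVIEW_R2: `c⁰ ≥ γv(R(τ₀) + 2) − (γ − 1)τ₀`) so that hole clocks lag the flat clock on certified
tubes (S9); `τ₀(d₂)` late enough that flat-late-on-tube ⇒ hole-late (`Rg` sublinear) and the flat `C⁰`
threshold `1/10` holds (S3); hole charts `:= Ψ'ᵢ` on `{rᵢ < Rgᵢ + 1}` and `:= Φ ∘ fold` beyond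
(glued on the open collar where both are `Φ`, A3; far leaves folded into the radiation zone, S10);
flat domain shrunk to the complement of the `ρ'`-tubes (S7, open because `ρ'` is continuous), flat
chart `:= Φ` restricted; `R := Rg` (re-clocked), `R₀' := R₁`.  Then S1, S2, S4, S5, S6, S8 are
A4/A5/A6/A7/A8/A3 re-clocked; S11 from `HonestFar`(2) and A1; `O = exteriorOf 𝒟 d₂.charted` and
`HonestCore(d₂)` (anchoring below later discs of every radius, relative closedness of tube portions)
from `HonestCore/HonestFar` of `d`, A1 (images inside `d.charted`), A2 and push-up in the Causality
API; separation/covering fields of the structure from those of `d`.  KNOWN DEFECT (inherited from the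
crux verbatim, not introduced here): S12 forces pairwise non-parallel `Λⱼe₀` (rattack EVIDENCE.md
§3), unsatisfiable for equal-velocity multi-hole inputs if such MGHDs exist (§4, physics-level open;
no Lean `¬`); the route's repair C′ adds distinct 3-velocities to `Hc`, after which this stub (with the
enlarged `HonestCore`) is the intended statement.  Why it might fail otherwise: a mis-set margin
(1/2/3/4) or clock clause — `misstated`, repaired by re-margining `NeckAtlas`. -/
def SeamSurgery : Prop :=
  ∀ (X : Type) [TopologicalSpace X] [ChartedSpace E3 X] [IsManifold (𝓡 3) ∞ X] [ConnectedSpace X]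
    (D : InitialDataSet (𝓡 3) X), D ∈ admissibleVacuumData X →
    ∀ 𝒟 : VacuumCauchyDevelopment D, 𝒟.IsMaximal →
    ∀ (O : Set 𝒟.carrier) (d : FinalStateDecomposition 𝒟.toSpacetime O 4) (R₀ : ℝ),
      O = exteriorOf 𝒟.toCauchyDevelopment d.charted →
      HonestCore 𝒟.toSpacetime O 4 d R₀ → HonestFar 𝒟.toSpacetime O 4 d R₀ →
      NeckAtlas 𝒟.toSpacetime O d R₀ →
      ∃ (d₂ : FinalStateDecomposition 𝒟.toSpacetime O 2) (R : Fin d₂.N → ℝ → ℝ) (R₀' : ℝ),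
        O = exteriorOf 𝒟.toCauchyDevelopment d₂.charted ∧ HonestCore 𝒟.toSpacetime O 2 d₂ R₀' ∧
          Seamed 𝒟.toSpacetime O d₂ R R₀'

/-- Registered stub N2 (statement = `SeamSurgery`, verbatim). -/
theorem stub_seamSurgery :
  ∀ (X : Type) [TopologicalSpace X] [ChartedSpace E3 X] [IsManifold (𝓡 3) ∞ X] [ConnectedSpace X]
    (D : InitialDataSet (𝓡 3) X), D ∈ admissibleVacuumData X →
    ∀ 𝒟 : VacuumCauchyDevelopment D, 𝒟.IsMaximal →
    ∀ (O : Set 𝒟.carrier) (d : FinalStateDecomposition 𝒟.toSpacetime O 4) (R₀ : ℝ),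
      O = exteriorOf 𝒟.toCauchyDevelopment d.charted →
      HonestCore 𝒟.toSpacetime O 4 d R₀ → HonestFar 𝒟.toSpacetime O 4 d R₀ →
      NeckAtlas 𝒟.toSpacetime O d R₀ →
      ∃ (d₂ : FinalStateDecomposition 𝒟.toSpacetime O 2) (R : Fin d₂.N → ℝ → ℝ) (R₀' : ℝ),
        O = exteriorOf 𝒟.toCauchyDevelopment d₂.charted ∧ HonestCore 𝒟.toSpacetime O 2 d₂ R₀' ∧
          Seamed 𝒟.toSpacetime O d₂ R R₀' := by
  sorry

/-! ## Named forms and registered aliases -/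

theorem tonelliBargmann_holds : TonelliBargmann := stub_tonelliBargmann
theorem characteristicCalculus_holds : CharacteristicCalculus := stub_characteristicCalculus
theorem bargmannSupContraction_holds : BargmannSupContraction :=
  stub_bargmannSupContraction stub_tonelliBargmann stub_characteristicCalculus
theorem noParkingDecay_holds : NoParkingDecay :=
  stub_noParkingDecay stub_tonelliBargmann stub_characteristicCalculus
theorem lateExteriorNoParking_holds :
    BargmannSupContraction → NoParkingDecay → LateExteriorNoParking := stub_lateExteriorNoParking
theorem seamSurgery_holds : SeamSurgery := stub_seamSurgery

/-! `Registered.stub_X` is the statement of the registered stub `stub_X` under the stub's own short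
name, so that the native skeleton audit (`#h21_check_skeleton`: hypotheses admissible iff route items or
registered stubs BY NAME) reads the hypotheses of `NecksCertify_of` as the six registered stubs. -/
namespace Registered

/-- Statement of `stub_tonelliBargmann`. -/
abbrev stub_tonelliBargmann : Prop := TonelliBargmann
/-- Statement of `stub_characteristicCalculus`. -/
abbrev stub_characteristicCalculus : Prop := CharacteristicCalculus
/-- Statement of `stub_bargmannSupContraction`. -/
abbrev stub_bargmannSupContraction : Prop :=
  TonelliBargmann → CharacteristicCalculus → BargmannSupContraction
/-- Statement of `stub_noParkingDecay`. -/
abbrev stub_noParkingDecay : Prop := TonelliBargmann → CharacteristicCalculus → NoParkingDecay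
/-- Statement of `stub_lateExteriorNoParking`. -/
abbrev stub_lateExteriorNoParking : Prop :=
  BargmannSupContraction → NoParkingDecay → LateExteriorNoParking
/-- Statement of `stub_seamSurgery`. -/
abbrev stub_seamSurgery : Prop := SeamSurgery

end Registered

/-- Consistency check: the registered stubs prove their name-keyed statements. -/
example : Registered.stub_tonelliBargmann ∧ Registered.stub_characteristicCalculus ∧
    Registered.stub_bargmannSupContraction ∧ Registered.stub_noParkingDecay ∧
    Registered.stub_lateExteriorNoParking ∧ Registered.stub_seamSurgery :=
  ⟨stub_tonelliBargmann, stub_characteristicCalculus, stub_bargmannSupContraction, stub_noParkingDecay,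
    stub_lateExteriorNoParking, stub_seamSurgery⟩

/-! ## The composition (kernel-checked, no sorry of its own) -/

/-- **Skeleton theorem.**  The six registered stubs imply the crux `StarvedNecks.NecksCertify` BY NAME:
instance-wise, the seam (N2) applied to the neck atlas produced by the late-exterior theorem (N1, fed
by the model rungs M1, M2, themselves fed by the Tonelli rung R1 and the characteristic calculus R2).
The crux's let-bound bundles `Hc`, `Hf`, `Sm` (inlined by the elaborator) are definitionally this file's
`HonestCore`, `HonestFar`, `Seamed` (verbatim bodies), so hypotheses and conclusion compose by `exact`. -/
theorem NecksCertify_of (hR1 : Registered.stub_tonelliBargmann)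
    (hR2 : Registered.stub_characteristicCalculus) (hM1 : Registered.stub_bargmannSupContraction)
    (hM2 : Registered.stub_noParkingDecay) (hN1 : Registered.stub_lateExteriorNoParking)
    (hN2 : Registered.stub_seamSurgery) :
    Summit.FinalStateConjecture.FinalStateConjecture.Theses.StarvedNecks.NecksCertify := by
  intro X _ _ _ _ D hD 𝒟 h𝒟 O d R₀ hO hc hf
  exact hN2 X D hD 𝒟 h𝒟 O d R₀ hO hc hf
    (hN1 (hM1 hR1 hR2) (hM2 hR1 hR2) X D hD 𝒟 h𝒟 O d R₀ hO hc hf)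

/-- Wiring check: the registered stubs feed `NecksCertify_of` as stated (an `example`, so that
`NecksCertify_of` stays the unique theorem of this file concluding the crux). -/
example : Summit.FinalStateConjecture.FinalStateConjecture.Theses.StarvedNecks.NecksCertify :=
  NecksCertify_of stub_tonelliBargmann stub_characteristicCalculus stub_bargmannSupContraction
    stub_noParkingDecay stub_lateExteriorNoParking stub_seamSurgery

end Summit.FinalStateConjecture.FinalStateConjecture.Cruxes.NecksCertify.BargmannSmallLateExterior

end
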